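import Summits.HubbardSuperconductivity.HubbardLadder.PairCorrSectorAssembly
import Summits.HubbardSuperconductivity.HubbardLadder.Bounds.TorusRayleighUpperRows
import Summits.HubbardSuperconductivity.HubbardLadder.Bounds.TorusSectorLowerRows
import HarnessLib

/-!
# Rung R3 tooling — ONE-SIDED ("half") pair–pair correlator rows from a SINGLE `pair_dd` list certificate
# (consumer of `PairCorrSectorCert` / `PairCorrSectorRows`; the one-file twin of `PairListWindowCert.ofSectorListCerts`)

HONEST FRAMING (page 1): ladder R1–R4 with certified numbers; no claim on H/H₀. This file proves SOUNDNESS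
EDGES only; no certificate of the kind it consumes exists (no `pair_dd` instance has been run by anyone; result
line (iii) of record: no R3 instance has been run; no dichotomy is certified at any size; there are no brackets to
overlap). Nothing here is a statement about `HubbardDisplaysSuperconductivity` / `H₀`.

WHY. The engines' `pair_dd` objective kind (FORMAT-certsdp1 addendum rev 3, P-1–P-5) produces ONE certificate per
file: a lower bound `q` on `⟨Σᵢ λᵢ V_{rᵢ}⟩` (plus, optionally, `a·⟨H⟩`, the `objective_h0_coeff`) over the states of a
joint sector `(N, S^z = M)` of the PHYSICAL `t–t'` torus Hamiltonian, under an `energy_upper u` hypothesis. The typed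
consumer is `TorusSectorObsCertTT' L t t' U N M u X q` (`PairCorrSectorCert`, #116). The two-sided rows of
`PairCorrSectorRows` / `PairCorrListRows` need a PAIR of files (`λ` and `−λ`). The first file anyone will hold is a
single one (the engines' prepared reader-validation case "PD1": `4 × 4`, `U = 4`, `N = 16`, `t' = 0`, class mean of
`P̄_d` over the displacement class `S((1,1)) = {(1,1),(1,3),(3,1),(3,3)}`; R3-PAIRROWS-SPEC §5‴). This file types
what ONE file gives:

* §1 `sum_avgPairCorr_ge_of_sectorListCert` — the HALF row (floor) `q/(m+1)² ≤ Σᵢ λᵢ P̄_d(m+1, rᵢ; ψ)` for every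
  unit ground state `ψ` of the sector, from a certificate for `X = pairListObjective (m+1) lam r` (`a = 0`);
  `sum_avgPairCorr_le_of_sectorListCert` — the ceiling twin from a certificate for the `−λ` list.
* §2 `sum_avgPairCorr_ge_of_sectorListCert_h0coeff` — the `a ≠ 0` variant
  (`X = a • H + pairListObjective …`): `(q − a·E)/(m+1)² ≤ Σᵢ λᵢ P̄_d` with `E` the sector ground energy, and its
  two numerically usable forms: `0 ≤ a` with an UPPER node `E ≤ u'`, `a ≤ 0` with a LOWER node `e ≤ E`.
* §3 the PD1-SHAPE instance (`4 × 4`, `t = 1`, `t' = 0`, `U = 4`, sector `(16, S^z = 0)`): the energy hypothesis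
  is discharged by ANY typed pure-model upper claim `groundEnergyAt (fermionTorusGraph 2 4) 1 4 16 ≤ u`
  (`minEnergyOn_szSector_zero_le_of_groundEnergyAt_le`, Lieb's `S^z = 0` representative, #117), in particular by
  the E2 node `Bounds.torusUpper_mbbootE2_4x4_U4_N16` (`u = −7488692256025/2³⁹`; class-mean reading
  `pairClassMeanFloor_4x4_U4_N16_tp0_of_mbbootE2_le`: `q/16 ≤ (Σᵢ P̄_d(4, rᵢ; ψ))/n`); and the `a ≤ 0` form keyed to
  the inherited LOWER node `Bounds.torusLower_mbboot_4x4_U4_N16`. No number is introduced: every constant is a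
  hypothesis or the constant of a typed node already in the tree.
* typed obligations `PairDDHalfRowsFourE2`, `PairDDHalfRowsFourH0coeff` (house style `@[conjecture] def` +
  `_holds`; both PROVED — implications from certificates nobody holds).

u-NODE RULE (recorded for the producer, R3-PAIRROWS-SPEC §5‴): `u` sits in the TYPE of the leaf; a file with
`κ > 0` is consumable as typed iff its `u` is ≥ the constant of a typed upper node at its point (monotonicity in `u`
is NOT available inside a fixed certificate: `κ (u' − u)` is not free); with `κ = 0` any `u` is vacuous.

References: WangEtAl2024 §3 (observable SDP bounds under an energy window), Han2020Bootstrap §2–§3, QinEtAl2020 §II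
eqs. (2)–(4) (the d-wave pair–pair correlator `P_d(r)`), LiebPRL1989 (the `S^z = 0` representative), Tasaki2020 §2.1.
Cell documents: `pub-hubbard-r3/R3-PAIRROWS-SPEC.md` §5′–§5‴, `pub-hubbard-r3/R3-DESIGN.md` §16–§17.
-/

noncomputable section

namespace Summit.HubbardSuperconductivity.HubbardLadder

open Matrix Finset Literature.MathematicalPhysics.QuantumLattice Literature.Probability.LatticeModels
open scoped ComplexOrder

/-! ## §1 Half rows from ONE list certificate (`objective_h0_coeff = 0`) -/

section Torus

variable {L : ℕ} [NeZero L]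

/-- **HALF row (floor) from ONE `pair_dd` list certificate.** A sector certificate with value `q` for the list
objective `Σᵢ λᵢ V_{rᵢ}` on side `m + 1`, joint sector `(N, S^z = M)`, energy-hypothesis constant `u` dominating
the sector ground energy, gives `q/(m+1)² ≤ Σᵢ λᵢ P̄_d(m+1, rᵢ; ψ)` for EVERY unit ground state `ψ` of that sector
(`TorusSectorObsCertTT'.re_expect_ge` + `re_expect_pairListObjective`). One file, one side. HONEST FRAMING: ladder
R1–R4 with certified numbers; no claim on H/H₀. [cite: QinEtAl2020, §II eqs. (2)–(4)] [cite: WangEtAl2024, §3 eq. (obsopt)] -/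
theorem sum_avgPairCorr_ge_of_sectorListCert (m : ℕ) (t t' U : ℝ) {N : ℕ} {M u q : ℝ} {n : ℕ}
    (lam : Fin n → ℝ) (r : Fin n → Site 2)
    (C : TorusSectorObsCertTT' (m + 1) t t' U N M u (pairListObjective (m + 1) lam r) q)
    (hE : (hubbardTorusTT' (m + 1) t t' U).minEnergyOn (szSector N M) ≤ u)
    (ψ : Fock (Orb (FermionTorus 2 (m + 1)))) (hψ1 : star ψ ⬝ᵥ ψ = 1)
    (hgs : IsGroundStateInSector (hubbardTorusTT' (m + 1) t t' U) N M ψ) :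
    q / ((m + 1 : ℕ) : ℝ) ^ 2 ≤ ∑ i, lam i * avgPairCorr (m + 1) (r i) ψ := by
  have hL2 : (0 : ℝ) < ((m + 1 : ℕ) : ℝ) ^ 2 := by positivity
  have h := C.re_expect_ge hE ψ hψ1 hgs
  rw [re_expect_pairListObjective] at h
  calc q / ((m + 1 : ℕ) : ℝ) ^ 2
      ≤ (((m + 1 : ℕ) : ℝ) ^ 2 * ∑ i, lam i * avgPairCorr (m + 1) (r i) ψ) / ((m + 1 : ℕ) : ℝ) ^ 2 :=
        div_le_div_of_nonneg_right h hL2.le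
    _ = ∑ i, lam i * avgPairCorr (m + 1) (r i) ψ := mul_div_cancel_left₀ _ hL2.ne'

/-- **HALF row (ceiling) from ONE certificate for the `−λ` list**: `Σᵢ λᵢ P̄_d(m+1, rᵢ; ψ) ≤ −q/(m+1)²`.
HONEST FRAMING: ladder R1–R4 with certified numbers; no claim on H/H₀. [cite: QinEtAl2020, §II eqs. (2)–(4)] -/
theorem sum_avgPairCorr_le_of_sectorListCert (m : ℕ) (t t' U : ℝ) {N : ℕ} {M u q : ℝ} {n : ℕ}
    (lam : Fin n → ℝ) (r : Fin n → Site 2)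
    (C : TorusSectorObsCertTT' (m + 1) t t' U N M u (pairListObjective (m + 1) (fun i => -lam i) r) q)
    (hE : (hubbardTorusTT' (m + 1) t t' U).minEnergyOn (szSector N M) ≤ u)
    (ψ : Fock (Orb (FermionTorus 2 (m + 1)))) (hψ1 : star ψ ⬝ᵥ ψ = 1)
    (hgs : IsGroundStateInSector (hubbardTorusTT' (m + 1) t t' U) N M ψ) :
    ∑ i, lam i * avgPairCorr (m + 1) (r i) ψ ≤ -q / ((m + 1 : ℕ) : ℝ) ^ 2 := by
  have h := sum_avgPairCorr_ge_of_sectorListCert m t t' U (fun i => -lam i) r C hE ψ hψ1 hgs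
  have hneg : ∑ i, -lam i * avgPairCorr (m + 1) (r i) ψ = -∑ i, lam i * avgPairCorr (m + 1) (r i) ψ := by
    rw [← Finset.sum_neg_distrib]
    exact Finset.sum_congr rfl fun i _ => by ring
  rw [hneg] at h
  rw [neg_div]
  linarith

/-- The MEAN reading of an equal-weight list: if `λᵢ = 1/n` for all `i` then `Σᵢ λᵢ P̄_d(rᵢ) = (Σᵢ P̄_d(rᵢ))/n`
(the producer's "class mean" over a displacement class, addendum P-3). [folklore] -/
theorem sum_const_inv_mul_eq_sum_div {n : ℕ} (F : Fin n → ℝ) :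
    ∑ i, (1 / (n : ℝ)) * F i = (∑ i, F i) / n := by
  rw [← Finset.mul_sum]
  ring

end Torus

/-! ## §2 The `objective_h0_coeff = a` variant (`X = a • H + Σᵢ λᵢ V_{rᵢ}`) -/

section H0Coeff

variable {L : ℕ} [NeZero L]

omit [NeZero L] in
/-- For a unit sector ground state, `Re ⟨ψ, H ψ⟩` is the sector ground energy. [folklore] -/
theorem re_expect_hamiltonian_of_isGroundStateInSector
    (H : Matrix (Finset (Orb (FermionTorus 2 L))) (Finset (Orb (FermionTorus 2 L))) ℂ) {N : ℕ} {M : ℝ}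
    (ψ : Fock (Orb (FermionTorus 2 L))) (hψ1 : star ψ ⬝ᵥ ψ = 1) (hgs : IsGroundStateInSector H N M ψ) :
    (star ψ ⬝ᵥ H *ᵥ ψ).re = H.minEnergyOn (szSector N M) := by
  rw [hgs.2.2, dotProduct_smul, hψ1, smul_eq_mul, mul_one, Complex.ofReal_re]

/-- **The `a ≠ 0` edge.** A sector certificate with value `q` for `X = a • H + Σᵢ λᵢ V_{rᵢ}` (the producer's
`objective_h0_coeff = a`), energy hypothesis `minEnergyOn ≤ u`, gives for every unit sector ground state `ψ`:
`(q − a·E)/(m+1)² ≤ Σᵢ λᵢ P̄_d(m+1, rᵢ; ψ)` where `E = minEnergyOn H (szSector N M)` is the sector ground energy.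
HONEST FRAMING: ladder R1–R4 with certified numbers; no claim on H/H₀. [cite: WangEtAl2024, §3 eq. (obsopt)] -/
theorem sum_avgPairCorr_ge_of_sectorListCert_h0coeff (m : ℕ) (t t' U : ℝ) {N : ℕ} {M u q : ℝ} {n : ℕ}
    (a : ℝ) (lam : Fin n → ℝ) (r : Fin n → Site 2)
    (C : TorusSectorObsCertTT' (m + 1) t t' U N M u
      (((a : ℝ) : ℂ) • hubbardTorusTT' (m + 1) t t' U + pairListObjective (m + 1) lam r) q)
    (hE : (hubbardTorusTT' (m + 1) t t' U).minEnergyOn (szSector N M) ≤ u)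
    (ψ : Fock (Orb (FermionTorus 2 (m + 1)))) (hψ1 : star ψ ⬝ᵥ ψ = 1)
    (hgs : IsGroundStateInSector (hubbardTorusTT' (m + 1) t t' U) N M ψ) :
    (q - a * (hubbardTorusTT' (m + 1) t t' U).minEnergyOn (szSector N M)) / ((m + 1 : ℕ) : ℝ) ^ 2
      ≤ ∑ i, lam i * avgPairCorr (m + 1) (r i) ψ := by
  have hL2 : (0 : ℝ) < ((m + 1 : ℕ) : ℝ) ^ 2 := by positivity
  have h := C.re_expect_ge hE ψ hψ1 hgs
  rw [add_mulVec, dotProduct_add, Complex.add_re, smul_mulVec, dotProduct_smul, smul_eq_mul,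
    Complex.re_ofReal_mul, re_expect_hamiltonian_of_isGroundStateInSector _ ψ hψ1 hgs,
    re_expect_pairListObjective] at h
  calc (q - a * (hubbardTorusTT' (m + 1) t t' U).minEnergyOn (szSector N M)) / ((m + 1 : ℕ) : ℝ) ^ 2
      ≤ (((m + 1 : ℕ) : ℝ) ^ 2 * ∑ i, lam i * avgPairCorr (m + 1) (r i) ψ) / ((m + 1 : ℕ) : ℝ) ^ 2 :=
        div_le_div_of_nonneg_right (by linarith) hL2.le
    _ = ∑ i, lam i * avgPairCorr (m + 1) (r i) ψ := mul_div_cancel_left₀ _ hL2.ne'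

/-- `0 ≤ a` with an UPPER node `E ≤ u'` (any typed upper claim at the point; `u' = u` allowed):
`(q − a u')/(m+1)² ≤ Σᵢ λᵢ P̄_d`. [cite: WangEtAl2024, §3 eq. (obsopt)] -/
theorem sum_avgPairCorr_ge_of_sectorListCert_h0coeff_nonneg (m : ℕ) (t t' U : ℝ) {N : ℕ} {M u q : ℝ}
    {n : ℕ} {a : ℝ} (ha : 0 ≤ a) (lam : Fin n → ℝ) (r : Fin n → Site 2)
    (C : TorusSectorObsCertTT' (m + 1) t t' U N M u
      (((a : ℝ) : ℂ) • hubbardTorusTT' (m + 1) t t' U + pairListObjective (m + 1) lam r) q)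
    (hE : (hubbardTorusTT' (m + 1) t t' U).minEnergyOn (szSector N M) ≤ u) {u' : ℝ}
    (hE' : (hubbardTorusTT' (m + 1) t t' U).minEnergyOn (szSector N M) ≤ u')
    (ψ : Fock (Orb (FermionTorus 2 (m + 1)))) (hψ1 : star ψ ⬝ᵥ ψ = 1)
    (hgs : IsGroundStateInSector (hubbardTorusTT' (m + 1) t t' U) N M ψ) :
    (q - a * u') / ((m + 1 : ℕ) : ℝ) ^ 2 ≤ ∑ i, lam i * avgPairCorr (m + 1) (r i) ψ := by
  have hL2 : (0 : ℝ) < ((m + 1 : ℕ) : ℝ) ^ 2 := by positivity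
  have h := sum_avgPairCorr_ge_of_sectorListCert_h0coeff m t t' U a lam r C hE ψ hψ1 hgs
  have hmono : a * (hubbardTorusTT' (m + 1) t t' U).minEnergyOn (szSector N M) ≤ a * u' :=
    mul_le_mul_of_nonneg_left hE' ha
  exact le_trans (div_le_div_of_nonneg_right (by linarith) hL2.le) h

/-- `a ≤ 0` with a LOWER node `e ≤ E` (a typed sector lower claim at the point):
`(q − a e)/(m+1)² ≤ Σᵢ λᵢ P̄_d`. [cite: Han2020Bootstrap, §2 eq. (2)–(4)] -/
theorem sum_avgPairCorr_ge_of_sectorListCert_h0coeff_nonpos (m : ℕ) (t t' U : ℝ) {N : ℕ} {M u q : ℝ}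
    {n : ℕ} {a : ℝ} (ha : a ≤ 0) (lam : Fin n → ℝ) (r : Fin n → Site 2)
    (C : TorusSectorObsCertTT' (m + 1) t t' U N M u
      (((a : ℝ) : ℂ) • hubbardTorusTT' (m + 1) t t' U + pairListObjective (m + 1) lam r) q)
    (hE : (hubbardTorusTT' (m + 1) t t' U).minEnergyOn (szSector N M) ≤ u) {e : ℝ}
    (he : e ≤ (hubbardTorusTT' (m + 1) t t' U).minEnergyOn (szSector N M))
    (ψ : Fock (Orb (FermionTorus 2 (m + 1)))) (hψ1 : star ψ ⬝ᵥ ψ = 1)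
    (hgs : IsGroundStateInSector (hubbardTorusTT' (m + 1) t t' U) N M ψ) :
    (q - a * e) / ((m + 1 : ℕ) : ℝ) ^ 2 ≤ ∑ i, lam i * avgPairCorr (m + 1) (r i) ψ := by
  have hL2 : (0 : ℝ) < ((m + 1 : ℕ) : ℝ) ^ 2 := by positivity
  have h := sum_avgPairCorr_ge_of_sectorListCert_h0coeff m t t' U a lam r C hE ψ hψ1 hgs
  have hmono : a * (hubbardTorusTT' (m + 1) t t' U).minEnergyOn (szSector N M) ≤ a * e :=
    mul_le_mul_of_nonpos_left he ha
  exact le_trans (div_le_div_of_nonneg_right (by linarith) hL2.le) h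

end H0Coeff

/-! ## §3 The PD1-shape instance: `4 × 4`, `t = 1`, `t' = 0`, `U = 4`, sector `(16, S^z = 0)` -/

section FourByFourHalf

/-- `8 ≤ |Λ| = 16` on the `4 × 4` torus (capacity check of the half-filled `(8,8)` sector). [folklore] -/
theorem eight_le_card_fermionTorus_four : 8 ≤ Fintype.card (FermionTorus 2 4) := by
  simp [FermionTorus, Fintype.card_pi]

/-- Energy-hypothesis glue at the PD1 point: ANY typed pure-model upper claim
`groundEnergyAt (fermionTorusGraph 2 4) 1 4 16 ≤ u` IS `minEnergyOn (hubbardTorusTT' 4 1 0 4) (szSector 16 0) ≤ u`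
(`minEnergyOn_szSector_zero_le_of_groundEnergyAt_le`, `16 = 2·8`, Lieb's `S^z = 0` representative). [cite: LiebPRL1989] -/
theorem minEnergyOn_szSector_4x4_U4_N16_tp0_le {u : ℝ}
    (hup : groundEnergyAt (fermionTorusGraph 2 4) 1 4 16 ≤ u) :
    (hubbardTorusTT' 4 1 0 4).minEnergyOn (szSector 16 0) ≤ u :=
  minEnergyOn_szSector_zero_le_of_groundEnergyAt_le (L := 4) 1 4 (nh := 8) eight_le_card_fermionTorus_four hup

/-- **PD1-shape HALF row, any typed upper node.** On the `4 × 4` torus at `t = 1`, `t' = 0`, `U = 4`, sector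
`(16, S^z = 0)`: ONE `pair_dd` list certificate (entries `(rᵢ, λᵢ)`, value `q`, energy-hypothesis constant `u`)
plus ANY typed upper claim `groundEnergyAt (fermionTorusGraph 2 4) 1 4 16 ≤ u` give, for every unit ground state
`ψ` of that sector of `hubbardTorusTT' 4 1 0 4` (`= hubbardTorus 2 4 1 4`, `hubbardTorusTT'_zero`):
`q/16 ≤ Σᵢ λᵢ P̄_d(4, rᵢ; ψ)`. For PD1 (`λ = 1/4` on `S((1,1))`) the right side is the class mean
(`sum_const_inv_mul_eq_sum_div`). NOT RUN. HONEST FRAMING: ladder R1–R4 with certified numbers; no claim on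
H/H₀. [cite: QinEtAl2020, §II eqs. (2)–(4)] -/
theorem pairListFloor_4x4_U4_N16_tp0_of_cert {n : ℕ} (lam : Fin n → ℝ) (r : Fin n → Site 2) {u q : ℝ}
    (C : TorusSectorObsCertTT' 4 1 0 4 16 0 u (pairListObjective 4 lam r) q)
    (hup : groundEnergyAt (fermionTorusGraph 2 4) 1 4 16 ≤ u)
    (ψ : Fock (Orb (FermionTorus 2 4))) (hψ1 : star ψ ⬝ᵥ ψ = 1)
    (hgs : IsGroundStateInSector (hubbardTorusTT' 4 1 0 4) 16 0 ψ) :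
    q / 16 ≤ ∑ i, lam i * avgPairCorr 4 (r i) ψ := by
  have h := sum_avgPairCorr_ge_of_sectorListCert 3 1 0 4 lam r C (minEnergyOn_szSector_4x4_U4_N16_tp0_le hup)
    ψ hψ1 hgs
  norm_num at h
  exact h

/-- **PD1-shape HALF ceiling** (a certificate for the `−λ` list): `Σᵢ λᵢ P̄_d(4, rᵢ; ψ) ≤ −q/16`. NOT RUN.
HONEST FRAMING: ladder R1–R4 with certified numbers; no claim on H/H₀. [cite: QinEtAl2020, §II eqs. (2)–(4)] -/
theorem pairListCeiling_4x4_U4_N16_tp0_of_cert {n : ℕ} (lam : Fin n → ℝ) (r : Fin n → Site 2) {u q : ℝ}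
    (C : TorusSectorObsCertTT' 4 1 0 4 16 0 u (pairListObjective 4 (fun i => -lam i) r) q)
    (hup : groundEnergyAt (fermionTorusGraph 2 4) 1 4 16 ≤ u)
    (ψ : Fock (Orb (FermionTorus 2 4))) (hψ1 : star ψ ⬝ᵥ ψ = 1)
    (hgs : IsGroundStateInSector (hubbardTorusTT' 4 1 0 4) 16 0 ψ) :
    ∑ i, lam i * avgPairCorr 4 (r i) ψ ≤ -q / 16 := by
  have h := sum_avgPairCorr_le_of_sectorListCert 3 1 0 4 lam r C (minEnergyOn_szSector_4x4_U4_N16_tp0_le hup)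
    ψ hψ1 hgs
  norm_num at h
  linarith

/-- **PD1-shape HALF row keyed to the E2 node** (`u = −7488692256025/2³⁹`, the constant of
`Bounds.torusUpper_mbbootE2_4x4_U4_N16`; a file written against any `u ≥` this constant is consumed through
`pairListFloor_4x4_U4_N16_tp0_of_cert` with `le_trans`). NOT RUN. HONEST FRAMING: ladder R1–R4 with certified
numbers; no claim on H/H₀. [cite: QinEtAl2020, §II eqs. (2)–(4)] [cite: Tasaki2020, §2.1] -/
theorem pairListFloor_4x4_U4_N16_tp0_of_mbbootE2 {n : ℕ} (lam : Fin n → ℝ) (r : Fin n → Site 2) {q : ℝ}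
    (C : TorusSectorObsCertTT' 4 1 0 4 16 0 ((-7488692256025 : ℝ) / 2 ^ 39) (pairListObjective 4 lam r) q)
    (hE2 : Bounds.torusUpper_mbbootE2_4x4_U4_N16)
    (ψ : Fock (Orb (FermionTorus 2 4))) (hψ1 : star ψ ⬝ᵥ ψ = 1)
    (hgs : IsGroundStateInSector (hubbardTorusTT' 4 1 0 4) 16 0 ψ) :
    q / 16 ≤ ∑ i, lam i * avgPairCorr 4 (r i) ψ :=
  pairListFloor_4x4_U4_N16_tp0_of_cert lam r C (Bounds.groundEnergyAt_4x4_U4_N16_le_of_claim hE2) ψ hψ1 hgs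

/-- The same for a file written against a WEAKER constant `u ≥ −7488692256025/2³⁹` (e.g. a rounded-up decimal):
the E2 node still discharges it. [cite: Tasaki2020, §2.1] -/
theorem pairListFloor_4x4_U4_N16_tp0_of_mbbootE2_le {n : ℕ} (lam : Fin n → ℝ) (r : Fin n → Site 2) {u q : ℝ}
    (hu : (-7488692256025 : ℝ) / 2 ^ 39 ≤ u)
    (C : TorusSectorObsCertTT' 4 1 0 4 16 0 u (pairListObjective 4 lam r) q)
    (hE2 : Bounds.torusUpper_mbbootE2_4x4_U4_N16)
    (ψ : Fock (Orb (FermionTorus 2 4))) (hψ1 : star ψ ⬝ᵥ ψ = 1)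
    (hgs : IsGroundStateInSector (hubbardTorusTT' 4 1 0 4) 16 0 ψ) :
    q / 16 ≤ ∑ i, lam i * avgPairCorr 4 (r i) ψ :=
  pairListFloor_4x4_U4_N16_tp0_of_cert lam r C
    (le_trans (Bounds.groundEnergyAt_4x4_U4_N16_le_of_claim hE2) hu) ψ hψ1 hgs

/-- **PD1 reading (CLASS MEAN), E2-keyed.** With equal weights `λᵢ = 1/n` on an `n`-list of displacements (the
producer's class mean over a displacement class, addendum P-3; PD1: `n = 4`, class `S((1,1))`), ONE certificate with
value `q` written against any `u ≥ −7488692256025/2³⁹` plus the E2 claim give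
`q/16 ≤ (Σᵢ P̄_d(4, rᵢ; ψ))/n` for every unit ground state `ψ` of the sector `(16, S^z = 0)`. NOT RUN. HONEST
FRAMING: ladder R1–R4 with certified numbers; no claim on H/H₀. [cite: QinEtAl2020, §II eqs. (2)–(4)] -/
theorem pairClassMeanFloor_4x4_U4_N16_tp0_of_mbbootE2_le {n : ℕ} (r : Fin n → Site 2) {u q : ℝ}
    (hu : (-7488692256025 : ℝ) / 2 ^ 39 ≤ u)
    (C : TorusSectorObsCertTT' 4 1 0 4 16 0 u (pairListObjective 4 (fun _ : Fin n => 1 / (n : ℝ)) r) q)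
    (hE2 : Bounds.torusUpper_mbbootE2_4x4_U4_N16)
    (ψ : Fock (Orb (FermionTorus 2 4))) (hψ1 : star ψ ⬝ᵥ ψ = 1)
    (hgs : IsGroundStateInSector (hubbardTorusTT' 4 1 0 4) 16 0 ψ) :
    q / 16 ≤ (∑ i, avgPairCorr 4 (r i) ψ) / n := by
  rw [← sum_const_inv_mul_eq_sum_div]
  exact pairListFloor_4x4_U4_N16_tp0_of_mbbootE2_le _ r hu C hE2 ψ hψ1 hgs

/-- **PD1-shape `a ≤ 0` form keyed to the inherited LOWER node** `Bounds.torusLower_mbboot_4x4_U4_N16`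
(`e = −16971178629544167090345781/2⁸⁰ ≤ groundEnergyAt (fermionTorusGraph 2 4) 1 4 16 = E(16, S^z=0)`):
`(q − a e)/16 ≤ Σᵢ λᵢ P̄_d(4, rᵢ; ψ)`. NOT RUN. HONEST FRAMING: ladder R1–R4 with certified numbers; no claim on
H/H₀. [cite: Han2020Bootstrap, §3] -/
theorem pairListFloor_4x4_U4_N16_tp0_h0coeff_nonpos_of_certs {n : ℕ} {a : ℝ} (ha : a ≤ 0)
    (lam : Fin n → ℝ) (r : Fin n → Site 2) {u q : ℝ}
    (C : TorusSectorObsCertTT' 4 1 0 4 16 0 u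
      (((a : ℝ) : ℂ) • hubbardTorusTT' 4 1 0 4 + pairListObjective 4 lam r) q)
    (hup : groundEnergyAt (fermionTorusGraph 2 4) 1 4 16 ≤ u)
    (hlo : Bounds.torusLower_mbboot_4x4_U4_N16)
    (ψ : Fock (Orb (FermionTorus 2 4))) (hψ1 : star ψ ⬝ᵥ ψ = 1)
    (hgs : IsGroundStateInSector (hubbardTorusTT' 4 1 0 4) 16 0 ψ) :
    (q - a * (-16971178629544167090345781 / 2 ^ 80 : ℝ)) / 16 ≤ ∑ i, lam i * avgPairCorr 4 (r i) ψ := by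
  have hge : (-16971178629544167090345781 / 2 ^ 80 : ℝ) ≤ (hubbardTorusTT' 4 1 0 4).minEnergyOn (szSector 16 0) := by
    have h1 := Bounds.groundEnergyAt_4x4_U4_N16_ge_of_claim hlo
    have h2 : groundEnergyAt (fermionTorusGraph 2 4) 1 4 16 =
        (hubbardTorusTT' 4 1 0 4).minEnergyOn (szSector 16 0) := by
      have h3 := groundEnergy_hubbardTorusTT'_eq_minEnergyOn_szSector 4 1 0 4 (n := 8)
        eight_le_card_fermionTorus_four
      rw [groundEnergy_hubbardTorusTT'_zero] at h3
      exact h3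
    linarith [h2.symm.le, h2.le]
  have h := sum_avgPairCorr_ge_of_sectorListCert_h0coeff_nonpos 3 1 0 4 ha lam r C
    (minEnergyOn_szSector_4x4_U4_N16_tp0_le hup) hge ψ hψ1 hgs
  norm_num at h ⊢
  linarith

/-- **PD1-shape `0 ≤ a` form keyed to the E2 UPPER node** (`u' = u = −7488692256025/2³⁹` or any typed upper):
`(q − a u')/16 ≤ Σᵢ λᵢ P̄_d(4, rᵢ; ψ)`. NOT RUN. HONEST FRAMING: ladder R1–R4 with certified numbers; no claim on
H/H₀. [cite: WangEtAl2024, §3 eq. (obsopt)] -/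
theorem pairListFloor_4x4_U4_N16_tp0_h0coeff_nonneg_of_certs {n : ℕ} {a : ℝ} (ha : 0 ≤ a)
    (lam : Fin n → ℝ) (r : Fin n → Site 2) {u u' q : ℝ}
    (C : TorusSectorObsCertTT' 4 1 0 4 16 0 u
      (((a : ℝ) : ℂ) • hubbardTorusTT' 4 1 0 4 + pairListObjective 4 lam r) q)
    (hup : groundEnergyAt (fermionTorusGraph 2 4) 1 4 16 ≤ u)
    (hup' : groundEnergyAt (fermionTorusGraph 2 4) 1 4 16 ≤ u')
    (ψ : Fock (Orb (FermionTorus 2 4))) (hψ1 : star ψ ⬝ᵥ ψ = 1)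
    (hgs : IsGroundStateInSector (hubbardTorusTT' 4 1 0 4) 16 0 ψ) :
    (q - a * u') / 16 ≤ ∑ i, lam i * avgPairCorr 4 (r i) ψ := by
  have h := sum_avgPairCorr_ge_of_sectorListCert_h0coeff_nonneg 3 1 0 4 ha lam r C
    (minEnergyOn_szSector_4x4_U4_N16_tp0_le hup) (minEnergyOn_szSector_4x4_U4_N16_tp0_le hup') ψ hψ1 hgs
  norm_num at h ⊢
  linarith

/-! ### Typed obligation (house style: `@[conjecture] def` + `_holds`; an implication from a certificate nobody holds) -/

/-- **Typed obligation — PD1-shape HALF rows from ONE `pair_dd` list certificate (E2-keyed).** On the `4 × 4`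
torus at `t = 1`, `t' = 0`, `U = 4`, sector `(16, S^z = 0)`: the E2 upper claim
`Bounds.torusUpper_mbbootE2_4x4_U4_N16` and ONE sector certificate for the list `(rᵢ, λᵢ)` (resp. `(rᵢ, −λᵢ)`)
with value `q`, written against `u = −7488692256025/2³⁹`, give the floor `q/16 ≤ Σᵢ λᵢ P̄_d(4, rᵢ; ψ)` (resp.
the ceiling `Σᵢ λᵢ P̄_d(4, rᵢ; ψ) ≤ −q/16`) for every unit ground state `ψ` of that sector. PROVED
(`pairDDHalfRowsFourE2_holds`); NO such certificate exists (PD1 is prepared by the engines, not run; it is not an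
R3 instance). HONEST FRAMING: ladder R1–R4 with certified numbers; no claim on H/H₀. -/
@[conjecture] def PairDDHalfRowsFourE2 : Prop :=
  ∀ (n : ℕ) (lam : Fin n → ℝ) (r : Fin n → Site 2) (q : ℝ),
    Bounds.torusUpper_mbbootE2_4x4_U4_N16 →
      (Nonempty (TorusSectorObsCertTT' 4 1 0 4 16 0 ((-7488692256025 : ℝ) / 2 ^ 39)
          (pairListObjective 4 lam r) q) →
        ∀ ψ : Fock (Orb (FermionTorus 2 4)), star ψ ⬝ᵥ ψ = 1 →
          IsGroundStateInSector (hubbardTorusTT' 4 1 0 4) 16 0 ψ →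
            q / 16 ≤ ∑ i, lam i * avgPairCorr 4 (r i) ψ) ∧
      (Nonempty (TorusSectorObsCertTT' 4 1 0 4 16 0 ((-7488692256025 : ℝ) / 2 ^ 39)
          (pairListObjective 4 (fun i => -lam i) r) q) →
        ∀ ψ : Fock (Orb (FermionTorus 2 4)), star ψ ⬝ᵥ ψ = 1 →
          IsGroundStateInSector (hubbardTorusTT' 4 1 0 4) 16 0 ψ →
            ∑ i, lam i * avgPairCorr 4 (r i) ψ ≤ -q / 16)

/-- **Proof of `PairDDHalfRowsFourE2`.** -/
theorem pairDDHalfRowsFourE2_holds : PairDDHalfRowsFourE2 := by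
  intro n lam r q hE2
  refine ⟨fun ⟨C⟩ ψ hψ1 hgs => pairListFloor_4x4_U4_N16_tp0_of_mbbootE2 lam r C hE2 ψ hψ1 hgs,
    fun ⟨C⟩ ψ hψ1 hgs => ?_⟩
  exact pairListCeiling_4x4_U4_N16_tp0_of_cert lam r C (Bounds.groundEnergyAt_4x4_U4_N16_le_of_claim hE2)
    ψ hψ1 hgs

/-- **Typed obligation — PD1-shape HALF rows with `objective_h0_coeff = a` (`X = a • H + Σᵢ λᵢ V_{rᵢ}`).** On the
`4 × 4` torus at `t = 1`, `t' = 0`, `U = 4`, sector `(16, S^z = 0)`: ONE sector certificate for `a • H + Σᵢ λᵢ V_{rᵢ}`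
with value `q` and energy-hypothesis constant `u`, plus a typed upper claim `groundEnergyAt (fermionTorusGraph 2 4) 1 4 16 ≤ u`,
give `(q − a u)/16 ≤ Σᵢ λᵢ P̄_d(4, rᵢ; ψ)` when `0 ≤ a`, and — with the inherited LOWER node
`Bounds.torusLower_mbboot_4x4_U4_N16` (`e = −16971178629544167090345781/2⁸⁰`) — `(q − a e)/16 ≤ Σᵢ λᵢ P̄_d(4, rᵢ; ψ)`
when `a ≤ 0`, for every unit ground state `ψ` of that sector. PROVED (`pairDDHalfRowsFourH0coeff_holds`); NO such
certificate exists. HONEST FRAMING: ladder R1–R4 with certified numbers; no claim on H/H₀. -/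
@[conjecture] def PairDDHalfRowsFourH0coeff : Prop :=
  ∀ (n : ℕ) (lam : Fin n → ℝ) (r : Fin n → Site 2) (a u q : ℝ),
    groundEnergyAt (fermionTorusGraph 2 4) 1 4 16 ≤ u →
      Nonempty (TorusSectorObsCertTT' 4 1 0 4 16 0 u
          (((a : ℝ) : ℂ) • hubbardTorusTT' 4 1 0 4 + pairListObjective 4 lam r) q) →
        (0 ≤ a → ∀ ψ : Fock (Orb (FermionTorus 2 4)), star ψ ⬝ᵥ ψ = 1 →
            IsGroundStateInSector (hubbardTorusTT' 4 1 0 4) 16 0 ψ →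
              (q - a * u) / 16 ≤ ∑ i, lam i * avgPairCorr 4 (r i) ψ) ∧
        (a ≤ 0 → Bounds.torusLower_mbboot_4x4_U4_N16 → ∀ ψ : Fock (Orb (FermionTorus 2 4)), star ψ ⬝ᵥ ψ = 1 →
            IsGroundStateInSector (hubbardTorusTT' 4 1 0 4) 16 0 ψ →
              (q - a * (-16971178629544167090345781 / 2 ^ 80 : ℝ)) / 16 ≤ ∑ i, lam i * avgPairCorr 4 (r i) ψ)

/-- **Proof of `PairDDHalfRowsFourH0coeff`.** -/
theorem pairDDHalfRowsFourH0coeff_holds : PairDDHalfRowsFourH0coeff := by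
  intro n lam r a u q hup hC
  obtain ⟨C⟩ := hC
  exact ⟨fun ha ψ hψ1 hgs => pairListFloor_4x4_U4_N16_tp0_h0coeff_nonneg_of_certs ha lam r C hup hup ψ hψ1 hgs,
    fun ha hlo ψ hψ1 hgs => pairListFloor_4x4_U4_N16_tp0_h0coeff_nonpos_of_certs ha lam r C hup hlo ψ hψ1 hgs⟩

end FourByFourHalf


end Summit.HubbardSuperconductivity.HubbardLadder
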